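import Summits.QuantumFields.BalabanUV.Beta.EriceRemainderEnclosureHistoryAutonomyComparisonAgeCompositionLevelGaugePrep

/-!
# EriceRemainderEnclosureHistoryAutonomyComparisonAgeCompositionLevelGauge — (E116d) route (N), first order: **THE END AT EVERY RANGE.**  Along EVERY
# admissible flow (isotone memory `B` with floor `b > 0` dominating `Σ_k L_k·u_k` on the ages `< K`, `L ≥ 0`, box solution `h`, levels `a_n = 1∕h(n)²`), for
# EVERY sub-profile (any finite set `O` of loaded ages, undamped tail-sum kernel), EVERY horizon `N ≥ K` and EVERY truncation `J ≤ N`, the zero-tailed solution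
# of `ε = 1_{[0,J]} − R ε` satisfies
#     **`ε(m)·h(m)² ≥ ε(m+1)·h(m+1)²` for every `m < J`**   (the solution over the level, `ε∕a`, is NON-INCREASING in the depth — **`flow_level_gauge`**),
# hence **`a_m∕a_J = h(J)²∕h(m)² ≤ ε(m) ≤ 1` for `m ≤ J`** and **`0 ≤ ε ≤ 1` at every depth** (**`flow_sol_ge_level_ratio`**, **`flow_nonneg_every_range`**).
# By (E115a) `sol_eq_sum_indicator` this is the END for every non-increasing zero-tailed excess: the first-order comparison system of route (N) (undamped) is
# NON-NEGATIVE FOR EVERY ADMISSIBLE PROFILE, with no ratio, range, mass or light-load hypothesis — the every-range END that READMEs g54–g96 pursued.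
#
# THE PROOF (README `HOME/b2b-balaban-beta-d4-p2/g97/README.md` §2): a ROW INDUCTION on the invariant «`ε∕a` non-increasing on `[m, J]`».  The differenced
# identity (E116a) `sol_step_eq_interior` gives `ε(m) ≥ (1 − F(m))·ε(m+1) − Σ_k (w_k(m) − w_k(m+1))·Σ_{1≤l<k} ε(m+1+l)` (outflow dropped by sign).  Per age `k`:
# the FIRST ENTRY `w_k(m) = L_kh(m+k)³∕2 ≤ (5∕8)·β_k(m+1)∕a_{m+k}` (`β_k(m+1) = L_kh(m+1+k)` the budget share, `a_{m+1+k} ≤ (25∕16)a_{m+k}`; `≤ β_1(m+1)∕a_{m+1}`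
# for `k = 1`); the DECAY `≤ (3∕4)·β_k(m+1)·Δa_{m+k+1}∕a_{m+k}²` ((E116b) `flow_rate_decay_le`); the interior window, BY THE INVARIANT, `≤ (ε(m+1)∕a_{m+1})·
# Σ_{l<k} a_{m+1+l}`; and the STIELTJES bound `Δa_{m+k+1}·Σ_{1≤l<k} a_{m+1+l} ≤ (a_{m+k} − a_{m+1})(a_{m+k} + a_{m+1} + Δa_{m+2})∕2` (the one late increment is
# below every interior increment — concavity of the levels, (E58b) `increment_anti`; (E116c) `stieltjes_sum_le`).  So age `k` costs at most `(β_k(m+1)∕a_{m+1})·ε(m+1)·Φ_k` with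
# `Φ_k = (5∕8)r + (3∕8)(1−r)(1+r+δ) ≤ 1` (`r = a_{m+1}∕a_{m+k}`, `δ = Δa_{m+2}∕a_{m+k} ≤ 1∕2`; the polynomial fact `(5∕8)AB + (3∕8)(A−B)(A+B+M) ≤ A²`), and the
# BUDGET `Σ_k β_k(m+1) ≤ Δa_{m+1}` ((E116b) `flow_budget_le`) sums the row to `ε(m) ≥ ε(m+1)·(1 − Δa_{m+1}∕a_{m+1}) = ε(m+1)·a_m∕a_{m+1}` — the invariant at `m`.
# Base: `ε(J) = 1`.  The only inputs are the budget of ONE row, the concavity of the levels and the cubic form of the rates: every loss of a row (first entries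
# and rate decay) is paid from the same increment `Δa_{m+1}` that raises the level, at an exchange rate `Φ ≤ 1`.  The lower bound `a_m∕a_J` is polynomially
# weak at the top (the truth is `≈ e^{−λT}`, README g96 §2) — and that is why it propagates.

Cell `pub-balaban`, β-function sub-cell, BINDER row D4 «RemainderConst leaves for Bałaban's split» (`HOME/BINDER-OWNERS.md`; owner lineage `b2b-balaban-beta-an4`;
this file by co-owner #2 lineage `b2b-balaban-beta-d4-p2`, generation 97), β-FLOW TEAM duty (1), FREEZE (0) honoured (def-free; imports (E116c)
`…LevelGaugePrep`; uses its `flow_lev_mono` ∕ `flow_age_one_le` ∕ `flow_age_ge_two_le`, (E116a) `sol_step_eq_interior` ∕ `sol_le_input`, (E116b)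
`flow_budget_le`, (E115f) `old_kernel_facts`, (E71a) `sol_eq_zero_of_tail`, (E48a) `strictAnti_of_memFlow` BY NAME; nothing restated).

HONEST FRAMING (page 1, verbatim and binding).  *"Discharging BetaPertH makes Bałaban's UV stability UNCONDITIONAL — a real constructive-QFT result; it is
NOT the continuum limit and NOT the Clay problem."*  THIS FILE DISCHARGES NOTHING OF THE KIND.  Elementary real analysis about ABSTRACT functionals on a box
]0,γ]^ℕ with displayed floors, profiles and signs, and the FIRST-ORDER, UNDAMPED renewal objects of route (N) built from them — hypotheses of a census, not
facts; the form, signs, ages and moments of Bałaban's (1.22) limit functional are NOT PRINTED ([I] p. 298; GAPS G-t4-U2-1∕-2) and NOT asserted.  Row D4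
class UNCHANGED (critical-path width 0; instance 0∕1; D4 DISCHARGE NO DATE).  HONEST DEPENDENCY: continuum YM on T⁴ ⇐ BetaPertH ∧ nine spine estimates
(0/9 proved); BetaPertH ⇐ (D1) ∧ (D4) ∧ CAP+tail; G-an2-4 gates asym, D1 and NE2/3/4.

WHAT THIS SETTLES AND WHAT NOT.  Settled: the every-range END of the UNDAMPED first-order comparison system (conjecture (E58′), route (N), in the form used by
(E71a)–(E115k): kernel `Σ_{k∈O} [l<k]·L_kh(m+k)³∕2`), for every admissible flow and profile — superseding the ratio ∕ light-load ∕ two- and three-age classes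
of (E86i), (E89b), (E91b), (E112a–e), (E115k) for this system.  NOT settled: the DAMPED system (pin damping `Π g_i`, `g_i = 1∕(1+f_i) ≤ 1`: the kernel is then
not of tail-sum form in the sense of (E115d)); anything nonlinear; anything printed — NOT B12 Thm 2, NOT BetaPertH, NOT continuum, NOT Clay.

WHAT IS PROVED ([folklore]; 0 `def`, 0 sorry; preparations in (E116c) `…LevelGaugePrep`).  §3 **`flow_level_gauge`**, **`flow_sol_ge_level_ratio`**,
**`flow_nonneg_every_range`**.
-/
noncomputable section
open Finset

namespace Summit.QuantumFields.BalabanUV.Beta.EriceRemainderEnclosureHistoryAutonomyComparisonAgeCompositionLevelGauge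

open Literature.MathematicalPhysics.QuantumFieldTheory.Balaban1983to89
open Literature.MathematicalPhysics.QuantumFieldTheory.Balaban1983to89.T4BetaStationary
open Literature.MathematicalPhysics.QuantumFieldTheory.Balaban1983to89.T4BetaFlowWellPosed
open Summit.QuantumFields.BalabanUV.Beta.EriceRemainderEnclosureHistoryAutonomyComparisonAgeComposition (sol_eq_zero_of_tail)
open Summit.QuantumFields.BalabanUV.Beta.EriceRemainderEnclosureHistoryAutonomyComparisonAgeCompositionReadVariation (read_eq_sum_ages)
open Summit.QuantumFields.BalabanUV.Beta.EriceRemainderEnclosureHistoryAutonomyComparisonAgeCompositionHeatingCriterion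
  (sol_step_eq_interior sol_le_input)
open Summit.QuantumFields.BalabanUV.Beta.EriceRemainderEnclosureHistoryAutonomyComparisonAgeCompositionHeatingCriterionFlow
  (flow_rate_decay_le flow_budget_le)
open Summit.QuantumFields.BalabanUV.Beta.EriceRemainderEnclosureHistoryAutonomyComparisonAgeCompositionYoungMass (old_kernel_facts)
open Summit.QuantumFields.BalabanUV.Beta.EriceRemainderEnclosureHistoryAutonomyComparisonAffineProfile (increment_anti)
open Summit.QuantumFields.BalabanUV.Beta.EriceRemainderEnclosureHistoryAutonomyOrder (strictAnti_of_memFlow)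
open Summit.QuantumFields.BalabanUV.Beta.EriceRemainderEnclosureHistoryAutonomyComparisonAgeCompositionLevelGaugePrep

variable {B : (ℕ → ℝ) → ℝ} {γ b gIR : ℝ} {L : ℕ → ℝ} {K : ℕ} {h : ℕ → ℝ}

/-! ## §3 The every-range END -/

/-- **THE LEVEL GAUGE: `ε∕a` IS NON-INCREASING IN THE DEPTH.**  `B` isotone with floor `b > 0` dominating `L ≥ 0` on the ages `< K`; `h` a box solution; `O` any
finite set of loaded ages with the undamped tail-sum kernel `K m l = Σ_{k∈(l,K)} w_O k m`, `w_O k m = [k ∈ O]·L_kh(m+k)³∕2`; horizon `N ≥ K`, `N ≥ 1`; `ε` the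
zero-tailed solution of `ε = 1_{[0,J]} − R ε`, `J ≤ N`.  Then for every `m < J`:  `ε(m+1)·h(m+1)² ≤ ε(m)·h(m)²`.  (Row induction on «`ε·h²` non-increasing on
`[m, J]`»: the invariant below the pin bounds the interior windows by the level, `flow_age_one_le` ∕ `flow_age_ge_two_le` price each age by its budget share,
and the row budget raises the level by exactly `Δa_{m+1}`.) [folklore] -/
theorem flow_level_gauge (hmono : ∀ u v : ℕ → ℝ, SeqBox γ u → SeqBox γ v → (∀ j, u j ≤ v j) → B u ≤ B v)
    (hL : ∀ k, 0 ≤ L k) (hb : 0 < b) (hlo : ∀ u, SeqBox γ u → b ≤ B u) (hdom : ∀ u, SeqBox γ u → ∑ k ∈ range K, L k * u k ≤ B u)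
    (hh : SeqBox γ h) (hf : MemFlow B gIR h) (O : Finset ℕ)
    {wO : ℕ → ℕ → ℝ} (hwO : ∀ k m, wO k m = if k ∈ O then L k * h (m + k) ^ 3 / 2 else 0)
    {N : ℕ} (hN : 1 ≤ N) (hKN : K ≤ N) {KO : ℕ → ℕ → ℝ} (hKO : ∀ m l, KO m l = ∑ k ∈ Ico (l + 1) K, wO k m)
    {R : (ℕ → ℝ) → ℕ → ℝ} (hR : ∀ u m, R u m = ∑ l ∈ range N, KO m l * u (m + 1 + l))
    {J : ℕ} (hJN : J ≤ N) {ε : ℕ → ℝ} (hεt : ∀ m, N < m → ε m = 0)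
    (hεrec : ∀ m, ε m = (fun n => if n ≤ J then (1 : ℝ) else 0) m - R ε m) :
    ∀ m, m < J → ε (m + 1) * h (m + 1) ^ 2 ≤ ε m * h m ^ 2 := by
  set e : ℕ → ℝ := fun n => if n ≤ J then (1 : ℝ) else 0 with he_def
  have hpos : ∀ j, 0 < h j := fun j => (hh j).1
  have hanti := (strictAnti_of_memFlow hb hlo hh hf).antitone
  obtain ⟨hw0, hwmono⟩ := old_kernel_facts hL hb hlo hh hf O hwO
  -- support beyond J and the value at J
  have het : ∀ n, N < n + (N - J) → e n = 0 := fun n hn => if_neg (show ¬ n ≤ J by omega)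
  have hεJ : ∀ n, J < n → ε n = 0 := fun n hn => sol_eq_zero_of_tail hR hεt hεrec het n (by omega)
  have hεJ1 : ε J = 1 := by
    rw [hεrec J]
    have hRJ : R ε J = 0 := by
      rw [hR]; exact sum_eq_zero fun l _ => by rw [hεJ (J + 1 + l) (by omega), mul_zero]
    simp only [he_def, hRJ, if_pos le_rfl, sub_zero]
  -- the row induction on «ε h² non-increasing on [m, J]»
  suffices hmain : ∀ d m, J ≤ m + d → ∀ n, m ≤ n → n < J → ε (n + 1) * h (n + 1) ^ 2 ≤ ε n * h n ^ 2 from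
    fun m hm => hmain J 0 (by omega) m (Nat.zero_le m) hm
  intro d
  induction d with
  | zero => intro m hm n hmn hnJ; omega
  | succ d ih =>
    intro m hm n hmn hnJ
    by_cases hmn' : m + 1 ≤ n
    · exact ih (m + 1) (by omega) n hmn' hnJ
    have hnm : n = m := by omega
    subst hnm
    -- below the pin: the invariant on [n+1, J]
    have hbelow : ∀ p, n + 1 ≤ p → p < J → ε (p + 1) * h (p + 1) ^ 2 ≤ ε p * h p ^ 2 := ih (n + 1) (by omega)
    -- chained: ε(n+1+l) h(n+1+l)² ≤ ε(n+1) h(n+1)² for n+1+l ≤ J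
    have hchain : ∀ l, n + 1 + l ≤ J → ε (n + 1 + l) * h (n + 1 + l) ^ 2 ≤ ε (n + 1) * h (n + 1) ^ 2 := by
      intro l
      induction l with
      | zero => intro _; simp
      | succ l ihl =>
        intro hl
        have h1 := hbelow (n + 1 + l) (by omega) (by omega)
        rw [show n + 1 + (l + 1) = n + 1 + l + 1 by ring]
        exact h1.trans (ihl (by omega))
    -- positivity on [n+1, J]: ε(p) h(p)² ≥ ε(J) h(J)² = h(J)² > 0
    have hposJ : ∀ p, n + 1 ≤ p → p ≤ J → 0 < ε p := by
      intro p hp1 hpJ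
      have hch : ∀ q, p + q ≤ J → ε (p + q) * h (p + q) ^ 2 ≤ ε p * h p ^ 2 := by
        intro q
        induction q with
        | zero => intro _; simp
        | succ q ihq =>
          intro hq
          have h1 := hbelow (p + q) (by omega) (by omega)
          rw [show p + (q + 1) = p + q + 1 by ring]
          exact h1.trans (ihq (by omega))
      have := hch (J - p) (by omega)
      rw [show p + (J - p) = J by omega, hεJ1, one_mul] at this
      have hJ2 : 0 < h J ^ 2 := pow_pos (hpos J) 2
      have hp2 : 0 < h p ^ 2 := pow_pos (hpos p) 2
      by_contra hneg
      have hneg' : ε p ≤ 0 := le_of_not_gt hneg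
      have : ε p * h p ^ 2 ≤ 0 := mul_nonpos_of_nonpos_of_nonneg hneg' hp2.le
      linarith
    have hnonneg : ∀ p, n + 1 ≤ p → 0 ≤ ε p := by
      intro p hp
      by_cases hpJ : p ≤ J
      · exact (hposJ p hp hpJ).le
      · rw [hεJ p (by omega)]
    have hε1 : 0 ≤ ε (n + 1) := hnonneg (n + 1) le_rfl
    -- level-gauge upper bounds on the interior windows: ε(n+1+l) ≤ ε(n+1) h(n+1)² / h(n+1+l)²
    have hgauge : ∀ l, ε (n + 1 + l) ≤ ε (n + 1) * h (n + 1) ^ 2 * (1 / h (n + 1 + l) ^ 2) := by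
      intro l
      have hl2 : 0 < h (n + 1 + l) ^ 2 := pow_pos (hpos _) 2
      by_cases hl : n + 1 + l ≤ J
      · have := hchain l hl
        rw [mul_one_div, le_div_iff₀ hl2]; exact this
      · rw [hεJ (n + 1 + l) (by omega)]
        have := hpos (n + 1); positivity
    -- the row identity and the per-age costs
    have hid := sol_step_eq_interior (A := K) (e := e) hR hKO hN hεrec n
    have hen : e n - e (n + 1) = 0 := by simp only [he_def]; rw [if_pos (by omega), if_pos (by omega)]; ring
    have hout : 0 ≤ ∑ k ∈ Ico 1 K, wO k (n + 1) * ε (n + 1 + min k N) :=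
      sum_nonneg fun k _ => mul_nonneg (hw0 k (n + 1)) (hnonneg _ (by omega))
    have hcost : ∑ k ∈ Ico 1 K, wO k n * ε (n + 1)
        + ∑ k ∈ Ico 1 K, (wO k n - wO k (n + 1)) * ∑ l ∈ Ico 1 (min k N), ε (n + 1 + l)
        ≤ (∑ k ∈ Ico 1 K, (if k ∈ O then L k * h (n + 1 + k) else 0)) * h (n + 1) ^ 2 * ε (n + 1) := by
      rw [← sum_add_distrib, sum_mul, sum_mul]
      refine sum_le_sum fun k hk => ?_
      have hk1 : 1 ≤ k := (mem_Ico.mp hk).1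
      have hkK : k < K := (mem_Ico.mp hk).2
      rw [min_eq_left (by omega : k ≤ N)]
      by_cases hkO : k ∈ O
      · rw [if_pos hkO]
        have hwn : wO k n = L k * h (n + k) ^ 3 / 2 := by rw [hwO, if_pos hkO]
        have hwn1 : wO k (n + 1) = L k * h (n + 1 + k) ^ 3 / 2 := by rw [hwO, if_pos hkO]
        rw [hwn, hwn1]
        by_cases hk2 : 2 ≤ k
        · -- interior window bound via the gauge
          have hS0 : 0 ≤ ∑ l ∈ Ico 1 k, ε (n + 1 + l) := sum_nonneg fun l _ => hnonneg _ (by omega)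
          have hS : ∑ l ∈ Ico 1 k, ε (n + 1 + l) ≤ ε (n + 1) * h (n + 1) ^ 2 * ∑ l ∈ Ico 1 k, 1 / h (n + 1 + l) ^ 2 := by
            rw [mul_sum]; exact sum_le_sum fun l _ => hgauge l
          have := flow_age_ge_two_le hmono hL hb hlo hh hf n hk2 hε1 hS0 hS
          linarith
        · have hk1' : k = 1 := by omega
          subst hk1'
          have hempty : ∑ l ∈ Ico 1 1, ε (n + 1 + l) = 0 := by simp
          rw [hempty, mul_zero, add_zero]
          have := flow_age_one_le hmono hL hb hlo hh hf n
          exact mul_le_mul_of_nonneg_right (by linarith) hε1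
      · rw [if_neg hkO]
        have hwn : wO k n = 0 := by rw [hwO, if_neg hkO]
        have hwn1 : wO k (n + 1) = 0 := by rw [hwO, if_neg hkO]
        rw [hwn, hwn1]; simp
    -- the budget of the row n+1
    have hbud : (∑ k ∈ Ico 1 K, (if k ∈ O then L k * h (n + 1 + k) else 0)) ≤ 1 / h (n + 1) ^ 2 - 1 / h n ^ 2 := by
      have hb' := flow_budget_le hdom hh hf n
      refine le_trans ?_ hb'
      calc ∑ k ∈ Ico 1 K, (if k ∈ O then L k * h (n + 1 + k) else 0) ≤ ∑ k ∈ Ico 1 K, L k * h (n + 1 + k) :=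
            sum_le_sum fun k _ => by
              split_ifs
              · exact le_rfl
              · exact mul_nonneg (hL k) (hpos _).le
        _ ≤ ∑ k ∈ range K, L k * h (n + 1 + k) := by
            refine sum_le_sum_of_subset_of_nonneg (fun k hk => mem_range.mpr (mem_Ico.mp hk).2) ?_
            intro k _ _; exact mul_nonneg (hL k) (hpos _).le
    -- assemble: ε n ≥ ε(n+1) − (Δa_{n+1} h(n+1)²) ε(n+1) = ε(n+1) h(n+1)²/h(n)²
    have hF : (∑ k ∈ Ico 1 K, wO k n) * ε (n + 1) = ∑ k ∈ Ico 1 K, wO k n * ε (n + 1) := by rw [sum_mul]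
    have hn2 : 0 < h n ^ 2 := pow_pos (hpos n) 2
    have hn12 : 0 < h (n + 1) ^ 2 := pow_pos (hpos (n + 1)) 2
    have hstep : ε (n + 1) * h (n + 1) ^ 2 * (1 / h n ^ 2) ≤ ε n := by
      have h1 : (∑ k ∈ Ico 1 K, (if k ∈ O then L k * h (n + 1 + k) else 0)) * h (n + 1) ^ 2 * ε (n + 1)
          ≤ (1 / h (n + 1) ^ 2 - 1 / h n ^ 2) * h (n + 1) ^ 2 * ε (n + 1) :=
        mul_le_mul_of_nonneg_right (mul_le_mul_of_nonneg_right hbud hn12.le) hε1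
      have e0 : (1 / h (n + 1) ^ 2 - 1 / h n ^ 2) * h (n + 1) ^ 2 = 1 - h (n + 1) ^ 2 * (1 / h n ^ 2) := by
        rw [sub_mul, one_div_mul_cancel (ne_of_gt hn12), mul_comm]
      rw [e0] at h1
      rw [hen] at hid
      nlinarith
    have e2 : ε (n + 1) * h (n + 1) ^ 2 * (1 / h n ^ 2) * h n ^ 2 = ε (n + 1) * h (n + 1) ^ 2 := by
      rw [mul_assoc, one_div_mul_cancel (ne_of_gt hn2), mul_one]
    have := mul_le_mul_of_nonneg_right hstep hn2.le
    rw [e2] at this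
    exact this

/-- **THE QUANTITATIVE END: `a_m∕a_J ≤ ε(m)`** for `m ≤ J`, i.e. `h(J)²∕h(m)² ≤ ε(m)` (the level gauge chained down to `ε(J) = 1`). [folklore] -/
theorem flow_sol_ge_level_ratio (hmono : ∀ u v : ℕ → ℝ, SeqBox γ u → SeqBox γ v → (∀ j, u j ≤ v j) → B u ≤ B v)
    (hL : ∀ k, 0 ≤ L k) (hb : 0 < b) (hlo : ∀ u, SeqBox γ u → b ≤ B u) (hdom : ∀ u, SeqBox γ u → ∑ k ∈ range K, L k * u k ≤ B u)
    (hh : SeqBox γ h) (hf : MemFlow B gIR h) (O : Finset ℕ)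
    {wO : ℕ → ℕ → ℝ} (hwO : ∀ k m, wO k m = if k ∈ O then L k * h (m + k) ^ 3 / 2 else 0)
    {N : ℕ} (hN : 1 ≤ N) (hKN : K ≤ N) {KO : ℕ → ℕ → ℝ} (hKO : ∀ m l, KO m l = ∑ k ∈ Ico (l + 1) K, wO k m)
    {R : (ℕ → ℝ) → ℕ → ℝ} (hR : ∀ u m, R u m = ∑ l ∈ range N, KO m l * u (m + 1 + l))
    {J : ℕ} (hJN : J ≤ N) {ε : ℕ → ℝ} (hεt : ∀ m, N < m → ε m = 0)
    (hεrec : ∀ m, ε m = (fun n => if n ≤ J then (1 : ℝ) else 0) m - R ε m) :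
    ∀ m, m ≤ J → h J ^ 2 / h m ^ 2 ≤ ε m := by
  have hpos : ∀ j, 0 < h j := fun j => (hh j).1
  have hg := flow_level_gauge hmono hL hb hlo hdom hh hf O hwO hN hKN hKO hR hJN hεt hεrec
  -- support and ε J = 1
  have het : ∀ n, N < n + (N - J) → (fun n => if n ≤ J then (1 : ℝ) else 0) n = 0 := fun n hn => if_neg (show ¬ n ≤ J by omega)
  have hεJ : ∀ n, J < n → ε n = 0 := fun n hn => sol_eq_zero_of_tail hR hεt hεrec het n (by omega)
  have hεJ1 : ε J = 1 := by
    rw [hεrec J]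
    have hRJ : R ε J = 0 := by
      rw [hR]; exact sum_eq_zero fun l _ => by rw [hεJ (J + 1 + l) (by omega), mul_zero]
    simp only [hRJ, if_pos le_rfl, sub_zero]
  -- chain
  have hch : ∀ q m, m + q = J → h J ^ 2 ≤ ε m * h m ^ 2 := by
    intro q
    induction q with
    | zero => intro m hm; rw [add_zero] at hm; subst hm; rw [hεJ1, one_mul]
    | succ q ih =>
      intro m hm
      have h1 := hg m (by omega)
      have h2 := ih (m + 1) (by omega)
      linarith
  intro m hm
  have := hch (J - m) m (by omega)
  rw [div_le_iff₀ (pow_pos (hpos m) 2)]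
  linarith

/-- **THE END AT EVERY RANGE.**  Same setting: `0 ≤ ε(m) ≤ 1` at EVERY depth, for EVERY admissible flow, EVERY sub-profile `O`, EVERY horizon `N ≥ K` and
EVERY truncation `J ≤ N` — no ratio, range, mass or light-load hypothesis.  (`flow_sol_ge_level_ratio` on `[0, J]`, the support beyond `J`, and (E116a)
`sol_le_input`.) [folklore] -/
theorem flow_nonneg_every_range (hmono : ∀ u v : ℕ → ℝ, SeqBox γ u → SeqBox γ v → (∀ j, u j ≤ v j) → B u ≤ B v)
    (hL : ∀ k, 0 ≤ L k) (hb : 0 < b) (hlo : ∀ u, SeqBox γ u → b ≤ B u) (hdom : ∀ u, SeqBox γ u → ∑ k ∈ range K, L k * u k ≤ B u)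
    (hh : SeqBox γ h) (hf : MemFlow B gIR h) (O : Finset ℕ)
    {wO : ℕ → ℕ → ℝ} (hwO : ∀ k m, wO k m = if k ∈ O then L k * h (m + k) ^ 3 / 2 else 0)
    {N : ℕ} (hN : 1 ≤ N) (hKN : K ≤ N) {KO : ℕ → ℕ → ℝ} (hKO : ∀ m l, KO m l = ∑ k ∈ Ico (l + 1) K, wO k m)
    {R : (ℕ → ℝ) → ℕ → ℝ} (hR : ∀ u m, R u m = ∑ l ∈ range N, KO m l * u (m + 1 + l))
    {J : ℕ} (hJN : J ≤ N) {ε : ℕ → ℝ} (hεt : ∀ m, N < m → ε m = 0)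
    (hεrec : ∀ m, ε m = (fun n => if n ≤ J then (1 : ℝ) else 0) m - R ε m) :
    ∀ m, 0 ≤ ε m ∧ ε m ≤ 1 := by
  have hpos : ∀ j, 0 < h j := fun j => (hh j).1
  obtain ⟨hw0, _⟩ := old_kernel_facts hL hb hlo hh hf O hwO
  have hlow := flow_sol_ge_level_ratio hmono hL hb hlo hdom hh hf O hwO hN hKN hKO hR hJN hεt hεrec
  have het : ∀ n, N < n + (N - J) → (fun n => if n ≤ J then (1 : ℝ) else 0) n = 0 := fun n hn => if_neg (show ¬ n ≤ J by omega)
  have hεJ : ∀ n, J < n → ε n = 0 := fun n hn => sol_eq_zero_of_tail hR hεt hεrec het n (by omega)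
  have hnn : ∀ m, 0 ≤ ε m := by
    intro m
    by_cases hm : m ≤ J
    · exact le_trans (by have := hpos J; have := hpos m; positivity) (hlow m hm)
    · rw [hεJ m (by omega)]
  intro m
  refine ⟨hnn m, ?_⟩
  have h1 := sol_le_input (A := K) hR hKO hw0 hεrec hnn m
  have h2 : (fun n => if n ≤ J then (1 : ℝ) else 0) m ≤ 1 := by simp only; split_ifs <;> norm_num
  exact h1.trans h2

end Summit.QuantumFields.BalabanUV.Beta.EriceRemainderEnclosureHistoryAutonomyComparisonAgeCompositionLevelGauge

end
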